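import Summits.PneNP.PneNP.Theorems.ChebyshevTracialDesignTwoBlockClassSplit
import Summits.PneNP.PneNP.Theorems.ChebyshevTracialDesignTiltedSmallBlockClasses
import HarnessLib

/-!
# Cell pnp-psdrank, route `ChebyshevTracialDesign`: TILTED JUNTAS — the containment form of an outer-constant direction on a class pattern
# (brick J4a = 163a; crux `TracialDecayExp20`, stmt-PneNP-19878)

Brick 163a (prover g31; MEMO-34 §6). For the class split of brick 163b along the internal edges `AA(H)` of a block `H`: a direction `v` that is
constant (`u₀`) on the edges outside `H` has, on the cuts `U` with a prescribed pattern `A` on `K = V(AA(H))`, the crossing-plane form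
`Σ_p v_p x_px_{πp} = Σ_{h∈S'∩H} α_h x_hx_{πh} + L_A + u₀·(#full outer edges)` with `α_h = v_h + v_{πh} − 2u₀` — i.e. the shape of brick 162c with
VERTEX-DEPENDENT tilt coefficients `|α_h| ≤ 4` (`sum_full_outerConstant_eq`, **`containment_union_pattern_J`**); `sum_div_card_le_of_le'`
(an average of terms `≤ B` is `≤ B`). §2 `identityColour_facts`: colour `H` by the identity (`p ↦ p+1`) and the rest by `0` — a colour-preserving
permutation fixes `H` pointwise (so `U ↦ f(U∩H)` is colour-symmetric for EVERY junta `f`), and a colour-type-constant direction field is constant on the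
vertices of the edges outside `H` (the input of bricks 148 §4 / 150b for 163d/163e). WHAT THIS FILE DOES NOT DO: the per-matching pricing (163b).
[cite: Rothvoss2017, §2 (PDF p. 6)]
Stature: support/instrument (kernel lane, no defs, axioms standard). WHAT THIS IS NOT: nothing on spread / non-junta masks (the open heart, N2), no proof or refutation of
`TracialDecayExp20`, nothing on psd rank of P_PM(K_n), no P-vs-NP content. Supports stmt-PneNP-19878.
-/

set_option linter.dupNamespace false -- `Summit.PneNP.PneNP.…`: summit = sub-problem (D-0017)

noncomputable section

namespace Summit.PneNP.PneNP.Theorems.ChebyshevTracialDesignTiltedJuntaClassSplit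

open Finset Polynomial Literature.Barriers.PneNP Literature.Combinatorics.Optimization
open Literature.Combinatorics.Optimization.ShellStep
open Summit.PneNP.PneNP.Theorems.ChebyshevTracialDesignShellOperatorForm (designValue_eq_shellAvg)
open Summit.PneNP.PneNP.Theorems.ChebyshevTracialDesignSmallBlockClassWeights
open Summit.PneNP.PneNP.Theorems.ChebyshevTracialDesignSmallBlockMaskPricingHH (sdiff_vAA_facts)
open Summit.PneNP.PneNP.Theorems.ChebyshevTracialDesignTwoBlockClassSplit (shellAvg_eq_sum_classWeight_mul_avg₂)

variable {n : ℕ}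

/-- An average of a finite family bounded by `B ≥ 0` is bounded by `B` (also when the family is empty). [folklore] -/
theorem sum_div_card_le_of_le' {ι : Type*} (s : Finset ι) (f : ι → ℝ) {B : ℝ} (hB : 0 ≤ B) (h : ∀ i ∈ s, f i ≤ B) :
    (∑ i ∈ s, f i) / (s.card : ℝ) ≤ B := by
  rcases s.eq_empty_or_nonempty with rfl | hne
  · simp [hB]
  · rw [div_le_iff₀ (by exact_mod_cast hne.card_pos)]
    calc ∑ i ∈ s, f i ≤ ∑ _i ∈ s, B := sum_le_sum h
      _ = B * s.card := by rw [sum_const, nsmul_eq_mul, mul_comm]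

/-! ### §1 The containment form of an outer-constant direction on a class pattern -/

section Pattern

variable {π : Fin n → Fin n} (hπ : ∀ v, π (π v) = v) (hπ' : ∀ v, π v ≠ v)
include hπ hπ'

omit hπ' in
/-- **The containment form of a direction constant on the out-out edges, on the full edges of a cut `B` of a ground set `S'` with no edge
inside `H`**: `Σ_{p∈full B} v_p = Σ_{h∈B∩H} α_h − Σ_{h∈S'∩H} α_h[h ∈ half B] + u₀(|B| − |half B|)`, `α_h = v_h + v_{πh} − 2u₀`.
[cite: Rothvoss2017, §2 (PDF pp. 5–6)] -/
theorem sum_full_outerConstant_eq {H S' : Finset (Fin n)} (hno : ∀ u ∈ S', ¬ (u ∈ H ∧ π u ∈ H))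
    (v : Fin n → ℝ) (u₀ : ℝ) (hv0 : ∀ p, p ∉ H → π p ∉ H → v p = u₀) {B : Finset (Fin n)} (hB : B ⊆ S') :
    ∑ p ∈ full π B, v p =
      (∑ h ∈ B ∩ H, (v h + v (π h) - 2 * u₀)) -
        (∑ h ∈ S' ∩ H, (v h + v (π h) - 2 * u₀) * (if (h ∈ B ∧ π h ∉ B) then (1 : ℝ) else 0)) +
        u₀ * ((B.card : ℝ) - ((half π B).card : ℝ)) := by
  classical
  -- sort the full vertices: in `H`, partner in `H`, neither
  have hstab : ∀ p ∈ full π B, π p ∈ full π B := fun p hp => by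
    obtain ⟨h1, h2⟩ := mem_full.1 hp; exact mem_full.2 ⟨h2, by rw [hπ]; exact h1⟩
  have hsplit : ∀ p ∈ full π B, v p = u₀ + (if p ∈ H then (v p - u₀) else 0) + (if π p ∈ H then (v p - u₀) else 0) := by
    intro p hp
    have hpS : p ∈ S' := hB (mem_full.1 hp).1
    by_cases h1 : p ∈ H
    · have h2 : π p ∉ H := fun h => hno p hpS ⟨h1, h⟩
      rw [if_pos h1, if_neg h2]; ring
    · by_cases h2 : π p ∈ H
      · rw [if_neg h1, if_pos h2]; ring
      · rw [if_neg h1, if_neg h2, hv0 p h1 h2]; ring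
  rw [sum_congr rfl hsplit, sum_add_distrib, sum_add_distrib, sum_const, nsmul_eq_mul]
  have e1 : ∑ p ∈ full π B, (if p ∈ H then (v p - u₀) else 0) = ∑ p ∈ full π B ∩ H, (v p - u₀) := by
    rw [← sum_filter, filter_mem_eq_inter]
  have e2 : ∑ p ∈ full π B, (if π p ∈ H then (v p - u₀) else 0) = ∑ p ∈ full π B ∩ H, (v (π p) - u₀) := by
    rw [← sum_filter]
    refine sum_nbij' (fun p => π p) (fun p => π p) (fun p hp => ?_) (fun p hp => ?_) (fun p _ => hπ p) (fun p _ => hπ p)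
      (fun p _ => by rw [hπ])
    · rw [mem_filter] at hp; rw [mem_inter]; exact ⟨hstab p hp.1, hp.2⟩
    · rw [mem_inter] at hp; rw [mem_filter]; exact ⟨hstab p hp.1, by rw [hπ]; exact hp.2⟩
  rw [e1, e2]
  -- `B ∩ H = (full B ∩ H) ⊔ (half B ∩ H)` and the half part as an indicator sum over `S' ∩ H`
  have e3 : ∑ h ∈ B ∩ H, (v h + v (π h) - 2 * u₀) =
      ∑ h ∈ full π B ∩ H, (v h + v (π h) - 2 * u₀) + ∑ h ∈ half π B ∩ H, (v h + v (π h) - 2 * u₀) := by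
    rw [← sum_union]
    · congr 1
      ext h
      simp only [mem_inter, mem_union, mem_full, mem_half]
      constructor
      · rintro ⟨hB', hH⟩; by_cases hp : π h ∈ B
        · exact Or.inl ⟨⟨hB', hp⟩, hH⟩
        · exact Or.inr ⟨⟨hB', hp⟩, hH⟩
      · rintro (⟨⟨h1, _⟩, h2⟩ | ⟨⟨h1, _⟩, h2⟩) <;> exact ⟨h1, h2⟩
    · exact disjoint_of_subset_left inter_subset_left (disjoint_of_subset_right inter_subset_left
        (disjoint_left.2 fun p hp hp' => (mem_half.1 hp').2 (mem_full.1 hp).2))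
  have e4 : ∑ h ∈ S' ∩ H, (v h + v (π h) - 2 * u₀) * (if (h ∈ B ∧ π h ∉ B) then (1 : ℝ) else 0) =
      ∑ h ∈ half π B ∩ H, (v h + v (π h) - 2 * u₀) := by
    rw [half_inter_eq_filter hB, sum_filter]
    exact sum_congr rfl fun h _ => by split_ifs <;> simp
  have e5 : ((full π B).card : ℝ) = (B.card : ℝ) - ((half π B).card : ℝ) := by
    have h := card_full_add_card_half (π := π) B
    have : ((full π B).card : ℝ) + ((half π B).card : ℝ) = (B.card : ℝ) := by exact_mod_cast h
    linarith
  rw [e3, e4, e5]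
  have e6 : ∑ p ∈ full π B ∩ H, (v p - u₀) + ∑ p ∈ full π B ∩ H, (v (π p) - u₀) =
      ∑ h ∈ full π B ∩ H, (v h + v (π h) - 2 * u₀) := by
    rw [← sum_add_distrib]; exact sum_congr rfl fun p _ => by ring
  linarith [e6]

omit hπ' in
/-- **The containment form on a class pattern, junta form.** `K = V(AA(H))`, `A ⊆ K`, `B ⊆ S' = [n] ∖ K`, `v` constant `u₀` on the out-out
edges: `(A∪B) ∩ H = (A∩H) ∪ (B∩H)` and
`Σ_p v_p x_p x_{πp}(A∪B) = Σ_{p∈full A} v_p + (Σ_{h∈B∩H} α_h − Σ_{h∈S'∩H} α_h[h ∈ half B]) + u₀(|B| − |half B|)`.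
[cite: Rothvoss2017, §2 (PDF pp. 5–6)] -/
theorem containment_union_pattern_J {H : Finset (Fin n)} (v : Fin n → ℝ) (u₀ : ℝ) (hv0 : ∀ p, p ∉ H → π p ∉ H → v p = u₀)
    {A B : Finset (Fin n)} (hA : A ⊆ vAA π univ H) (hB : B ⊆ univ \ vAA π univ H) :
    (A ∪ B) ∩ H = (A ∩ H) ∪ (B ∩ H) ∧
    ∑ p : Fin n, v p * ((if p ∈ A ∪ B then (1 : ℝ) else 0) * (if π p ∈ A ∪ B then (1 : ℝ) else 0)) =
      (∑ p ∈ full π A, v p) +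
        ((∑ h ∈ B ∩ H, (v h + v (π h) - 2 * u₀)) -
          (∑ h ∈ (univ \ vAA π univ H) ∩ H, (v h + v (π h) - 2 * u₀) * (if (h ∈ B ∧ π h ∉ B) then (1 : ℝ) else 0)) +
          u₀ * ((B.card : ℝ) - ((half π B).card : ℝ))) := by
  classical
  have hK : ∀ p, p ∈ vAA π univ H ↔ p ∈ H ∧ π p ∈ H := fun p => by rw [mem_vAA]; simp
  have hAK : ∀ p ∈ A, p ∈ H ∧ π p ∈ H := fun p hp => (hK p).1 (hA hp)
  have hBK : ∀ p ∈ B, ¬ (p ∈ H ∧ π p ∈ H) := fun p hp => fun h => (mem_sdiff.1 (hB hp)).2 ((hK p).2 h)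
  refine ⟨union_inter_distrib_right _ _ _, ?_⟩
  have hx : ∀ p : Fin n, ((if p ∈ A ∪ B then (1 : ℝ) else 0) * (if π p ∈ A ∪ B then (1 : ℝ) else 0)) =
      (if p ∈ full π A then (1 : ℝ) else 0) + (if p ∈ full π B then (1 : ℝ) else 0) := by
    intro p
    by_cases hpA : p ∈ A
    · have hpK := hAK p hpA
      have hpB : p ∉ B := fun h => hBK p h hpK
      have hπpB : π p ∉ B := fun h => hBK (π p) h ⟨hpK.2, by rw [hπ]; exact hpK.1⟩
      rw [if_pos (mem_union_left _ hpA), if_neg (fun h => hpB (mem_full.1 h).1)]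
      by_cases hπpA : π p ∈ A
      · rw [if_pos (mem_union_left _ hπpA), if_pos (mem_full.2 ⟨hpA, hπpA⟩)]; ring
      · rw [if_neg (fun h => (mem_union.1 h).elim hπpA hπpB), if_neg (fun h => hπpA (mem_full.1 h).2)]; ring
    · rw [if_neg (fun h => hpA (mem_full.1 h).1)]
      by_cases hpB : p ∈ B
      · have hpK := hBK p hpB
        have hπpA : π p ∉ A := fun h => hpK (by have := hAK _ h; rw [hπ] at this; exact ⟨this.2, this.1⟩)
        rw [if_pos (mem_union_right _ hpB)]
        by_cases hπpB : π p ∈ B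
        · rw [if_pos (mem_union_right _ hπpB), if_pos (mem_full.2 ⟨hpB, hπpB⟩)]; ring
        · rw [if_neg (fun h => (mem_union.1 h).elim hπpA hπpB), if_neg (fun h => hπpB (mem_full.1 h).2)]; ring
      · rw [if_neg (fun h => (mem_union.1 h).elim hpA hpB), if_neg (fun h => hpB (mem_full.1 h).1)]; ring
  simp only [hx, mul_add, sum_add_distrib]
  have hFA : ∑ p : Fin n, v p * (if p ∈ full π A then (1 : ℝ) else 0) = ∑ p ∈ full π A, v p := by
    simp only [mul_ite, mul_one, mul_zero]
    rw [← sum_filter, filter_mem_eq_inter, univ_inter]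
  have hFB : ∑ p : Fin n, v p * (if p ∈ full π B then (1 : ℝ) else 0) = ∑ p ∈ full π B, v p := by
    simp only [mul_ite, mul_one, mul_zero]
    rw [← sum_filter, filter_mem_eq_inter, univ_inter]
  have hS'no : ∀ u ∈ univ \ vAA π univ H, ¬ (u ∈ H ∧ π u ∈ H) := fun u hu h => (mem_sdiff.1 hu).2 ((hK u).2 h)
  rw [hFA, hFB, sum_full_outerConstant_eq hπ hS'no v u₀ hv0 hB]

end Pattern

/-! ### §2 The identity colouring of a block -/

/-- **The identity colouring of a block.** With `col p = p+1` on `H` and `0` off `H` (`n+1` colours): a permutation preserving `col` fixes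
`H` pointwise, so a junta of the in-set `U ∩ H` is colour-symmetric; a field that depends only on the unordered colour type
`s(col p, col πp)` is constant on the vertices of the edges outside `H`. [cite: Rothvoss2017, §2 (PDF p. 5)] -/
theorem identityColour_facts (H : Finset (Fin n)) :
    ∃ col : Fin n → Fin (n + 1), (∀ p, col p = 0 ↔ p ∉ H) ∧
      (∀ (g : Equiv.Perm (Fin n)), (∀ i, col (g i) = col i) → ∀ U : Finset (Fin n), U.map g.toEmbedding ∩ H = U ∩ H) ∧
      ∀ (π : Fin n → Fin n) (v : Fin n → ℝ), (∀ p p', s(col p, col (π p)) = s(col p', col (π p')) → v p = v p') →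
        ∀ p p', p ∉ H → π p ∉ H → p' ∉ H → π p' ∉ H → v p = v p' := by
  classical
  set col : Fin n → Fin (n + 1) := fun p => if p ∈ H then ⟨p.1 + 1, Nat.succ_lt_succ p.2⟩ else 0 with hcol
  have hc0 : ∀ p, col p = 0 ↔ p ∉ H := by
    intro p
    rw [hcol]
    simp only
    split_ifs with h
    · simp only [h, not_true_eq_false, iff_false]
      intro e
      have := congrArg Fin.val e
      simp at this
    · simp [h]
  have hinj : ∀ p q, p ∈ H → col p = col q → q = p := by
    intro p q hp e
    have hq : q ∈ H := by
      by_contra hq'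
      have : col q = 0 := (hc0 q).2 hq'
      rw [this] at e
      exact ((hc0 p).1 e) hp
    rw [hcol] at e
    simp only [hp, hq, if_true] at e
    have := congrArg Fin.val e
    simp at this
    exact Fin.ext this.symm
  refine ⟨col, hc0, ?_, ?_⟩
  · intro g hg U
    ext x
    simp only [mem_inter, mem_map_equiv]
    constructor
    · rintro ⟨hx, hxH⟩
      have e : col (g (g.symm x)) = col (g.symm x) := hg _
      rw [Equiv.apply_symm_apply] at e
      have := hinj x (g.symm x) hxH e
      rw [this] at hx; exact ⟨hx, hxH⟩
    · rintro ⟨hx, hxH⟩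
      have e : col (g x) = col x := hg x
      have h1 := hinj x (g x) hxH e.symm
      refine ⟨?_, hxH⟩
      rw [← h1, Equiv.symm_apply_apply]; exact hx
  · intro π v hvt p p' h1 h2 h3 h4
    refine hvt p p' ?_
    rw [(hc0 p).2 h1, (hc0 _).2 h2, (hc0 p').2 h3, (hc0 _).2 h4]

end Summit.PneNP.PneNP.Theorems.ChebyshevTracialDesignTiltedJuntaClassSplit

end
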